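import Literature.MathematicalPhysics.QuantumLattice.PhaseGaugeRelabel
import Literature.MathematicalPhysics.QuantumLattice.FockGaugeAction
import Literature.MathematicalPhysics.QuantumLattice.BdGBondHamiltonian
import Literature.MathematicalPhysics.QuantumLattice.FermionEmbedLocality
import HarnessLib

/-!
# Locality of the site-phase (gauge) conjugation on the CAR algebra

Topic `Literature/MathematicalPhysics/QuantumLattice` (namespace = path). Model-free bricks for gauge
arguments on finite fermion systems (Koma–Tasaki's site-phase unitaries `W_g = phaseGauge g`,
`g : Λ → U(1)`; Bratteli–Robinson's gauge automorphisms): the conjugation `A ↦ W_g A W_gᴴ` of an element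
`A` of the CAR subalgebra `𝔄(W)` of a site set `W` depends only on the restriction `g|_W`, and a CONSTANT
phase acts on `A` through its `U(1)` charge — trivially on gauge-invariant `A`.

* `phaseGauge_conj_eq_of_eqOn` — `g = g'` on `W`, `A ∈ carSubalgebra (orbs W)` ⇒
  `W_g A W_gᴴ = W_{g'} A W_{g'}ᴴ` (induction on the generators `c_{xσ}^{(†)}`, `x ∈ W`, with
  `W_g c_{xσ} W_gᴴ = conj(g x) c_{xσ}`);
* `phaseGauge_const_exp` — the constant site phase `e^{iθ}` is the number gauge unitary:
  `phaseGauge (fun _ => Circle.exp θ) = fockGaugeU1 θ` (`= e^{iθN̂}`);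
* `phaseGauge_const_conj_eq_of_hasGaugeCharge_zero` — for gauge-invariant `A` (`HasGaugeCharge 0 A`)
  and every `c ∈ U(1)`: `W_c A W_cᴴ = A`;
* `phaseGauge_conj_eq_of_eqOn_mul_const` — combination: if `g' = c · g` on `W` and `A ∈ 𝔄(W)` is
  gauge invariant, `W_{g'} A W_{g'}ᴴ = W_g A W_gᴴ`.

Written for the Hubbard cuprate cell (`hubbard-cq`, row T8 «sourced helicity chord», TL-existence route
of hubbard-cq-p5's SUCCESSOR PLAN, step 3: on each translate of the window the LOCAL twist gauge agrees
with the GLOBAL boost up to a constant phase, which the gauge-invariant hopping density does not see).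
Everything PROVED; no definition, no named fact.

References: T. Koma, H. Tasaki, Phys. Rev. Lett. 68 (1992) 3248, eqs. (7)–(8); O. Bratteli,
D. W. Robinson, *Operator Algebras and Quantum Statistical Mechanics 2* (1997), §5.2.2.
-/

noncomputable section

namespace Literature.MathematicalPhysics.QuantumLattice

open _root_.Matrix Finset HubbardWave0
open scoped ComplexConjugate

variable {Λ : Type*} [LinearOrder Λ] [Fintype Λ]

/-- **Gauge conjugation is local**: if `g` and `g'` agree on the site set `W` then
`W_g A W_gᴴ = W_{g'} A W_{g'}ᴴ` for every `A` in the CAR subalgebra of the orbitals over `W`.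
[cite: BratteliRobinsonII1997, §5.2.2] -/
theorem phaseGauge_conj_eq_of_eqOn (g g' : Λ → Circle) {W : Finset Λ} (hgg' : ∀ x ∈ W, g x = g' x)
    {A : Matrix (Finset (Orb Λ)) (Finset (Orb Λ)) ℂ} (hA : A ∈ carSubalgebra (orbs W)) :
    phaseGauge g * A * (phaseGauge g)ᴴ = phaseGauge g' * A * (phaseGauge g')ᴴ := by
  induction hA using Algebra.adjoin_induction with
  | mem x hx =>
    obtain ⟨l, hl, rfl⟩ := hx
    have hy : (ofLex l.1).1 ∈ W := mem_orbs.1 hl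
    have horb : l.1 = orb (ofLex l.1).1 (ofLex l.1).2 := rfl
    obtain ⟨o, b⟩ := l
    cases b
    · have e : letterOp (o, false) = annihilation (orb (ofLex o).1 (ofLex o).2) := by
        rw [letterOp]; rfl
      rw [e, phaseGauge_mul_annihilation_mul_conjTranspose, phaseGauge_mul_annihilation_mul_conjTranspose,
        hgg' _ hy]
    · have e : letterOp (o, true) = creation (orb (ofLex o).1 (ofLex o).2) := by
        rw [letterOp]; rfl
      rw [e, phaseGauge_mul_creation_mul_conjTranspose, phaseGauge_mul_creation_mul_conjTranspose,
        hgg' _ hy]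
  | algebraMap r =>
    rw [Algebra.algebraMap_eq_smul_one, Matrix.mul_smul, Matrix.mul_one, Matrix.smul_mul,
      phaseGauge_mul_conjTranspose_self, Matrix.mul_smul, Matrix.mul_one, Matrix.smul_mul,
      phaseGauge_mul_conjTranspose_self]
  | add x y _ _ hx hy => rw [Matrix.mul_add, Matrix.add_mul, hx, hy, Matrix.mul_add, Matrix.add_mul]
  | mul x y _ _ hx hy =>
    rw [phaseGauge_mul_mul_mul_conjTranspose, hx, hy, ← phaseGauge_mul_mul_mul_conjTranspose]

omit [Fintype Λ] in
/-- **A constant site phase is the number gauge unitary**: `phaseGauge (fun _ => e^{iθ}) = e^{iθN̂}`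
(`fockGaugeU1 θ` on the orbitals `Λ × {↑,↓}`). [cite: BratteliRobinsonII1997, §5.2.2] -/
theorem phaseGauge_const_exp (θ : ℝ) :
    phaseGauge (fun _ : Λ => Circle.exp θ) = (fockGaugeU1 θ : Matrix (Finset (Orb Λ)) (Finset (Orb Λ)) ℂ) := by
  rw [phaseGauge_eq, fockGaugeU1]
  congr 1
  funext s
  rw [Finset.prod_const, Circle.coe_pow, Circle.coe_exp, ← Complex.exp_nat_mul]
  congr 1
  ring

/-- **A constant phase acts trivially on gauge-invariant elements**: for `A` of `U(1)` charge `0`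
and every `c ∈ U(1)`, `W_c A W_cᴴ = A`. [cite: BratteliRobinsonII1997, §5.2.2] -/
theorem phaseGauge_const_conj_eq_of_hasGaugeCharge_zero (c : Circle)
    {A : Matrix (Finset (Orb Λ)) (Finset (Orb Λ)) ℂ} (hA : HasGaugeCharge 0 A) :
    phaseGauge (fun _ : Λ => c) * A * (phaseGauge (fun _ : Λ => c))ᴴ = A := by
  rw [← Circle.exp_arg c, phaseGauge_const_exp, ← gaugeAut_apply]
  exact hA.gaugeAut_eq _

/-- **Local gauge up to a constant**: if `g' x = c · g x` on `W` and `A ∈ 𝔄(W)` is gauge invariant,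
then `W_{g'} A W_{g'}ᴴ = W_g A W_gᴴ` (the translate of a window twist agrees with the global boost up
to a constant phase, invisible to gauge-invariant densities). [cite: KomaTasakiPRL1992, eqs. (7)–(8)] -/
theorem phaseGauge_conj_eq_of_eqOn_mul_const (g g' : Λ → Circle) (c : Circle) {W : Finset Λ}
    (hgg' : ∀ x ∈ W, g' x = c * g x) {A : Matrix (Finset (Orb Λ)) (Finset (Orb Λ)) ℂ}
    (hA : A ∈ carSubalgebra (orbs W)) (h0 : HasGaugeCharge 0 A) :
    phaseGauge g' * A * (phaseGauge g')ᴴ = phaseGauge g * A * (phaseGauge g)ᴴ := by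
  rw [phaseGauge_conj_eq_of_eqOn g' (fun x => c * g x) (fun x hx => hgg' x hx) hA]
  have hsplit : phaseGauge (fun x : Λ => c * g x) = phaseGauge g * phaseGauge (fun _ : Λ => c) := by
    rw [phaseGauge_mul]
    congr 1
    funext x
    exact mul_comm _ _
  rw [hsplit, conjTranspose_mul]
  calc phaseGauge g * phaseGauge (fun _ : Λ => c) * A * ((phaseGauge (fun _ : Λ => c))ᴴ * (phaseGauge g)ᴴ)
      = phaseGauge g * (phaseGauge (fun _ : Λ => c) * A * (phaseGauge (fun _ : Λ => c))ᴴ) * (phaseGauge g)ᴴ := by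
        simp only [Matrix.mul_assoc]
    _ = phaseGauge g * A * (phaseGauge g)ᴴ := by rw [phaseGauge_const_conj_eq_of_hasGaugeCharge_zero c h0]

end Literature.MathematicalPhysics.QuantumLattice

end
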